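import Summits.MatrixMultiplication.MatrixMultiplication.Theorems.AbelianSTPPCensusTAStatDefs
import Summits.MatrixMultiplication.MatrixMultiplication.Theorems.AbelianSTPPCensusTD2StatData
import Summits.MatrixMultiplication.MatrixMultiplication.Theorems.AbelianSTPPCensusTD2GainTable247
import Summits.MatrixMultiplication.MatrixMultiplication.Theorems.AbelianSTPPCensusTAStatKMember

/-!
# T_D static certificate, second range `628 … 667`: theory's t*-indexed linear checker with the k-member bucket-descent tree at `τ = 247/100` (definitions)

Cell mm-stpp (rung F-M1), tier T_D = «beat `2.47`, i.e. every abelian STPP construction of the CKSU era»; successor kernel item of the closed crux item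
stmt-MatrixMultiplication-19191, seat mm-stpp-vp-p2 (gen 5); second T_D range after `AbelianSTPPCensusTDStatDefs.lean` (gen 4, universe `627`, where the
one-member static relaxation ends: first uncovered order `629`; with the two-member device of `AbelianSTPPCensusTAStatTwoMember.lean` `630`).  This file is
theory g12's `AbelianSTPPCensusTAStatDDefs.lean` (fourth T_A range; design `AbelianSTPPCensusTAStatDefs.lean`, theory g11) with the range constants and the gain
exchanged — universe `Mtop = 667`, orders `lo = 628 … 667`, table `TD2StatData.E` (25 levels × 62 buckets), gains `ShapeCert.gainOfTDY`
(`AbelianSTPPCensusTD2GainTable247.lean`), budget parameter of a bucket = its lower end (`tp = tb`) — and ONE structural change: the fallback of a failing one-member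
`cover` in the bucket walk is the k-member bucket-descent TREE `TAStatKM.coverK` of `AbelianSTPPCensusTAStatKMember.lean` (at most `kmax = 8` explicit members;
the bucket lists `TD2StatData.M2` are complete for EVERY bucket, checked by `m2V`), i.e. the walk is `TAStatKM.walk3`.  The data-free parts (`TAStat.tm`, `e0`, `domP`,
`leP`, `leW`, `vpI`, `p1I`, `p2I`, `p3I`, `piece`, `pcs`, `vpCand`, `vpThresh`, `cover`; `TAStat2M.tiOK`; `TAStatKM.testK/goI/treeK/rootK/coverK/walk3`) are reused by name.
Exact integer twin: seat calc/twomember/tastat7.py (run `td_667_60`, `JOB_K=8`, single parameter `t = TB[j]`: all 82288 (shape, bucket) cells of the orders `628 … 667` pass,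
35 of them through the tree with 22146 tree nodes in all; the tree family first fails at order `668`, where `(7,7,8)⁴ + (7,7,7)` passes vM ∪ U11-G ∪ E3 and beats `2.47`).
Soundness: `AbelianSTPPCensusTD2Stat{Rows,Sound}.lean`; kernel evaluations `…TD2StatDom*/Ck*/M2c*`; leaf `AbelianSTPPCensusLeafTD667Closed.lean` (`noAbelianSTPPHostUpTo_247_667`).
WHAT THIS IS NOT: no statement about STPP families or `ω` — arithmetic on shape lists only; nothing about orders `> 667` or `< 628`.
-/

set_option linter.dupNamespace false
set_option autoImplicit false

namespace Summit.MatrixMultiplication.MatrixMultiplication.Theorems.TD2Stat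

open TECert (tableOK vol us)
open ShapeCert (gainOfTDY D)
open TD2StatData (E VL TB M2 M2F)
open TAStat (tm Entry e0 domP leP leW vpI p1I p2I p3I piece pcs vpCand vpThresh cover)

/-! ## Parameters -/

/-- Largest order of the certificate (= the order of the single-member table defining the candidate shapes). -/
def Mtop : ℕ := 667
/-- Least order of this range (orders `≤ 627`: `noAbelianSTPPHostUpTo_247_627`). -/
def lo : ℕ := 628
/-- Number of sub-intervals of orders on which the vM bound is re-checked by endpoint evaluation when one interval does not suffice. -/
def J : ℕ := 12
/-- Largest number of explicit members in a tree node (the maximal member and `kmax − 1` companions). -/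
def kmax : ℕ := 8

/-! ## Candidate shapes (sorted), levels and buckets -/

/-- The sorted candidate shapes `(a, b, c)`, `a ≤ b ≤ c`, of volume exactly `V`, passing `TECert.tableOK` at order `Mtop`
(`a ≤ 8`, `b ≤ 25` suffice since `9³ = 729 > Mtop` and `26² = 676 > Mtop`). -/
def triplesS (V : ℕ) : List (ℕ × ℕ × ℕ) :=
  (List.range 8).flatMap fun a' =>
    if V % (a' + 1) = 0 then
      (List.range 25).filterMap fun b' =>
        if a' ≤ b' ∧ V / (a' + 1) % (b' + 1) = 0 ∧ b' + 1 ≤ V / (a' + 1) / (b' + 1) ∧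
            tableOK Mtop (a' + 1) (b' + 1) (V / (a' + 1) / (b' + 1)) = true then
          some (a' + 1, b' + 1, V / (a' + 1) / (b' + 1))
        else none
    else []

/-- level of a volume: the first index `i` with `V ≤ VL[i]` (`VL.length` if none). -/
def levOf (V : ℕ) : ℕ := VL.findIdx fun vl => decide (V ≤ vl)

/-- bucket of a parameter `t ≥ 1`: the last index `j` with `TB[j] ≤ t` (computed as (first index with `t < TB[j]`) − 1). -/
def bucketOf (t : ℕ) : ℕ := (TB.findIdx fun b => decide (t < b)) - 1

/-- lower end `TB[j]` of bucket `j` (default `1000` beyond the list, which keeps `tb` monotone and below `10⁶` everywhere — the form the tree's soundness consumes) -/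
def tb (j : ℕ) : ℕ := TB.getD j 1000

/-- budget parameter of bucket `j`: in this range the bucket's own lower end `TB[j]` (the `TP`-clauses of `monoOK` hold trivially) -/
def tp (j : ℕ) : ℕ := tb j

/-- second-member list of bucket `j` (default `[]`) -/
def m2l (j : ℕ) : List (ℕ × ℕ × ℕ) := M2.getD j []

/-- list flag of bucket `j` (default `false`): `M2[j]` is complete for the bucket (here every bucket `< nb`) -/
def m2f (j : ℕ) : Bool := M2F.getD j false

/-! ## The table entries -/

/-- entry `(i, j)` of the table -/
def ent (i j : ℕ) : Entry := (E.getD i []).getD j e0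

/-- the table row of the level of a volume `V`, as a function of the bucket (read by the tree at every bucket it visits) -/
def rowOf (V : ℕ) (j : ℕ) : Entry := (E.getD (levOf V) []).getD j e0

/-- U11-G domination of a shape (gain `g`, volume `V`, pair-product sum `p`) along a table row from bucket `j` on, each entry read at its own bucket
budget parameter `t = TP[j]`: `V < t·p` and `g·wW ≤ gW·(t·p − V)`. -/
def domWrow (g V p : ℕ) : List Entry → ℕ → Bool
  | [], _ => true
  | e :: es, j => Nat.blt V (tp j * p) && Nat.ble (g * e.2.2.2) (e.2.2.1 * (tp j * p - V)) && domWrow g V p es (j + 1)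

/-- domination of one sorted candidate shape `x` of volume `V` (gain `g`): vM at its own (level, bucket), U11-G at its own level and every bucket
from its own on. -/
def domX (V g : ℕ) (x : ℕ × ℕ × ℕ) : Bool :=
  domP g (us x) ((E.getD (levOf V) []).getD (bucketOf (tm x)) e0) &&
    domWrow g V (us x) ((E.getD (levOf V) []).drop (bucketOf (tm x))) (bucketOf (tm x))

/-- every sorted candidate shape of the volumes `V, …, V + n − 1` is dominated (`domX`) -/
def domV : ℕ → ℕ → Bool
  | 0, _ => true
  | n + 1, V => (triplesS V).all (domX V (gainOfTDY V)) && domV n (V + 1)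

/-- Structural facts about the data, all checked by evaluation: every row has `nb` entries; all denominators are positive; the vM fraction is
monotone in the level and in the bucket, the U11-G fraction is monotone in the level; `TB[0] = 1`, `TB` is increasing with `TB[j+1] ≤ 2·TB[j]`
and (`TB[j] ≤ 1` or `TB[j+1] ≤ TB[j]²`); `TP[j] = TB[j]` or `19 ≤ TP[j]`, and `TP[j] ≤ TB[j]`. -/
def monoOK (nl nb : ℕ) : Bool :=
  Nat.beq (tb 0) 1 &&
  (List.range nl).all (fun i => Nat.beq (E.getD i []).length nb &&
    (List.range nb).all (fun j =>
      Nat.ble 1 (ent i j).2.1 && Nat.ble 1 (ent i j).2.2.2 &&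
      (Nat.ble (nl - 1) i || (leP (ent i j) (ent (i + 1) j) && leW (ent i j) (ent (i + 1) j))) &&
      (Nat.ble (nb - 1) j || leP (ent i j) (ent i (j + 1))))) &&
  (List.range nb).all (fun j => Nat.blt (tb j) (tb (j + 1)) && Nat.ble (tb (j + 1)) (2 * tb j) &&
    (Nat.ble (tb j) 1 || Nat.ble (tb (j + 1)) (tb j * tb j)) &&
    (Nat.beq (tp j) (tb j) || Nat.ble 19 (tp j)) && Nat.ble (tp j) (tb j))

/-! ## The checks (data-free parts reused from `TAStat`) -/

/-- Walk the buckets `j, j+1, …` of a table row (the row dropped to index `j`) for a maximal member (gain `g`, pair-product sum `p`, volume `V`, excess `d`,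
smallest size `al`, least pair product `tl`) whose own bucket is `j0`: `TAStatKM.walk3` with this range's data — escape by `tiOK V (TB[j])`, else the
one-member `cover` at `t = TB[j]` or the k-member tree `TAStatKM.coverK` (complete bucket lists `M2`, full row `rowOf V`, at most `kmax` explicit members). -/
def walk (g p V d al tl L H j0 : ℕ) (row : List Entry) (j : ℕ) : Bool :=
  TAStatKM.walk3 tb m2l gainOfTDY (rowOf V) tp g p V d al tl kmax L H j0 row j

/-- The check of one sorted candidate shape `x` of volume `V` (gain `g`) as the maximal-volume member, for all orders `max(lo, V+1) … Mtop` and all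
buckets from that of `x.1·x.2.1` on (smallest size `x.1`, least pair product `x.1·x.2.1` for the tree's `l`-source test). -/
def checkShape (V g : ℕ) (x : ℕ × ℕ × ℕ) : Bool :=
  Nat.blt Mtop (max lo (V + 1)) ||
    walk g (us x) V (2 * us x - (x.1 + x.2.1 + x.2.2)) x.1 (x.1 * x.2.1) (max lo (V + 1)) Mtop (bucketOf (x.1 * x.2.1))
      ((E.getD (levOf V) []).drop (bucketOf (x.1 * x.2.1))) (bucketOf (x.1 * x.2.1))

/-- every sorted candidate shape of the volumes `V, …, V + n − 1` passes `checkShape` -/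
def checkV : ℕ → ℕ → Bool
  | 0, _ => true
  | n + 1, V => (triplesS V).all (checkShape V (gainOfTDY V)) && checkV n (V + 1)

/-- completeness of the second-member lists on the volumes `V, …, V + n − 1`: every sorted candidate shape whose bucket is flagged is listed there -/
def m2V : ℕ → ℕ → Bool
  | 0, _ => true
  | n + 1, V => (triplesS V).all (fun x => !(m2f (bucketOf (x.1 * x.2.1))) || (m2l (bucketOf (x.1 * x.2.1))).elem x) && m2V n (V + 1)

/-! ## Specification vocabulary of the soundness proof (checker-internal predicates, no claims) -/

/-- Sorted candidate shapes: `1 ≤ a ≤ b ≤ c` and the single-member table at order `Mtop`. [bookkeeping] -/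
def SCand (x : ℕ × ℕ × ℕ) : Prop :=
  1 ≤ x.1 ∧ x.1 ≤ x.2.1 ∧ x.2.1 ≤ x.2.2 ∧ tableOK Mtop x.1 x.2.1 x.2.2 = true

end Summit.MatrixMultiplication.MatrixMultiplication.Theorems.TD2Stat
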